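import Summits.ResolutionOfSingularities.ResolutionOfSingularities.Theorems.EquisingularLiftEquisingularLiftNatSNCStepAlgebra
import Summits.ResolutionOfSingularities.ResolutionOfSingularities.Theorems.FrobeniusClosingPatchingRelPerfectDepthSNCPointwiseTransport
import Literature.AlgebraicGeometry.Resolution.AlterationsSectionDivisor
import Literature.AlgebraicGeometry.Resolution.BlowupRestrictOpen
import Literature.AlgebraicGeometry.Resolution.StrictTransformBaseChange
import HarnessLib

/-!
# (B3b) support II — the chart package at a point of a blow-up over an snc centre, relative to a TRANSVERSAL member, and the stalkwise
# commutation of strict transforms with the restriction to the closed-immersion models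

[OURS · L1 W4.5b · EL♮(3) stmt-ResolutionOfSingularities-20148 · desk R31 (β) DEAL «ND-K5» brick (B3b) · res-L1-w45b-stub-2 g14] — NOT a statement of the manuscript [Hironaka2017]; counted 0; AI kernel work weaker than expert review.

For a blow-up `π : W' → W` of a centre `C`, a list `L` with simple normal crossings WITH `C` at `π w'` (`DepthSNC.SNCWithAt`, pointwise) and a
member `Φ ∈ L` whose germ at `π w'` is NOT contained in the germ of `C` (the special fibre, transversal to every stratum):

* `exists_rsop_labels_over_centre` — `𝒪_{W',w'}` has a regular system of parameters `v` with positions `a₀ ≠ c₀` such that the TOTAL and the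
  STRICT transform of `Φ` both have stalk `(v a₀)`, the exceptional ideal has stalk `(v c₀)`, and every other member's strict transform has stalk
  `⊤` or `(v b)` at a third position (`ChartData.exists_rsop` / `stalkIdeal_strictTransform_w/_x/_x_self` / `stalkIdeal_exceptional` of the tree's
  `BlowupSNC.lean`, through W5.2's `exists_chartData_of_sncWithAt`);
* `stalkIdeal_strictTransformIdeal_eq_comap_of_transversal` — `(St_π Φ)_{w'} = (Φ·𝒪_{W'})_{w'}` at every `w'`;
  `stalkIdeal_strictTransformIdeal_ne_comap`, `stalkIdeal_exceptional_ne_comap` — the germs of the members' strict transforms and of the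
  exceptional ideal differ from the germ of `Φ·𝒪_{W'}` wherever both pass (off the centre: `IsBlowup.isIso_stalkMap_of_not_mem_support`);
* `stalkIdeal_comap_strictTransformIdeal_eq_of_sncWithAt` — for the model square `(j', υ; τX, jm)` of a strata step (`jm` a closed immersion,
  `Φ = ker jm`): `((St_{τX} K)·𝒪_{F₂})_y = (St_υ (K·𝒪_F))_y` at every `y` whose image carries the pointwise snc data — `≤` is the tree's
  `comap_strictTransformIdeal_le`, `≥` is the saturation of `((St K)·𝒪_{F₂})_y` by the exceptional ideal, read through
  `𝒪_{X₂,j'y} ↠ 𝒪_{F₂,y}` (kernel = the fibre's germ, `stalkIdeal_ker_eq_ker_stalkMap`) from the three distinct r.s.p. positions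
  (`colon_span_pow_le_of_isRsopPart`).

[cite: Kollar2007, Def. 3.25] [cite: GortzWedhorn2020, (13.19) p. 414] [cite: StacksProject, Tag 0804] [cite: Matsumura1987, Thm. 14.3]
-/

set_option linter.dupNamespace false -- mandated namespace `Summit.<Summit>.<Problem>` of this single-conjunct summit

noncomputable section

open CategoryTheory CategoryTheory.Limits AlgebraicGeometry TopologicalSpace Topology IsLocalRing
open Literature.AlgebraicGeometry.Resolution
open AlgebraicGeometry.Scheme.IdealSheafData
open Summit.ResolutionOfSingularities.ResolutionOfSingularities.Theorems.DepthSNC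

namespace Summit.ResolutionOfSingularities.ResolutionOfSingularities.Cruxes.EquisingularLiftNat.Sections.ND

universe u

/-! ## The chart package at a point of the blow-up over the centre (pointwise `SNCWithAt` hypotheses) -/

section Charts

variable {W W' : Scheme.{u}} [IsLocallyNoetherian W] [IsLocallyNoetherian W'] {π : W' ⟶ W} {C : W.IdealSheafData}
  (hπ : IsBlowup π C) {L : List W.IdealSheafData} {Φ : W.IdealSheafData} (hΦ : Φ ∈ L) (w' : W')
  (hLC : SNCWithAt L C (π w')) (hΦC : ¬ stalkIdeal Φ (π w') ≤ stalkIdeal C (π w'))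

include hπ hΦ hLC hΦC in
/-- **Labelled regular system of parameters at a point over the centre, relative to a transversal member `Φ`.** For a blow-up
`π` of a centre `C`, a list `L` having snc with `C` at `π w' ∈ V(C) ∩ V(Φ)`, and a member `Φ ∈ L` whose germ at `π w'` is not contained in
the germ of `C`: `𝒪_{W',w'}` has a regular system of parameters `v` with two distinct positions `a₀ ≠ c₀` such that the total AND the strict
transform of `Φ` have stalk `(v a₀)`, the exceptional ideal has stalk `(v c₀)`, and the strict transform of every other member of `L` through
`π w'` has stalk `⊤` or `(v b)` at a third position `b`. [cite: Kollar2007, Def. 3.25] [cite: StacksProject, Tag 0804] -/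
theorem exists_rsop_labels_over_centre (hwC : π w' ∈ C.support) (hwΦ : π w' ∈ Φ.support) :
    ∃ (d : ℕ) (v : Fin d → W'.presheaf.stalk w') (a₀ c₀ : Fin d),
      (maximalIdeal (W'.presheaf.stalk w')).spanFinrank = d ∧ Ideal.span (Set.range v) = maximalIdeal (W'.presheaf.stalk w') ∧
      IsRegularLocalRing (W'.presheaf.stalk w') ∧ a₀ ≠ c₀ ∧
      stalkIdeal (Φ.comap π) w' = Ideal.span {v a₀} ∧
      stalkIdeal (strictTransformIdeal π C Φ) w' = Ideal.span {v a₀} ∧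
      stalkIdeal (C.comap π) w' = Ideal.span {v c₀} ∧
      ∀ K ∈ L, π w' ∈ K.support → K ≠ Φ →
        stalkIdeal (strictTransformIdeal π C K) w' = ⊤ ∨
        ∃ b, b ≠ a₀ ∧ b ≠ c₀ ∧ stalkIdeal (strictTransformIdeal π C K) w' = Ideal.span {v b} := by
  obtain ⟨D, τl, hτinj, hτ⟩ := exists_chartData_of_sncWithAt hπ w' hLC hwC
  obtain ⟨hreg', d, v, hd, hv, lab, hlab, hvn, hvl, hvr⟩ := D.exists_rsop hwC
  -- the stalk of the centre in terms of the generators of the chart data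
  have hCst : stalkIdeal C (π w') = Ideal.span (Set.range fun j => (W.presheaf.germ D.U (π w') D.hxU).hom (D.x j)) := by
    rw [stalkIdeal_eq_map_germ C D.U D.hxU, ← D.hspanC, Ideal.map_span, ← Set.range_comp]
    rfl
  -- `Φ` is labelled by a `w`-coordinate
  set Φl : {K // K ∈ L ∧ π w' ∈ K.support} := ⟨Φ, hΦ, hwΦ⟩ with hΦl
  have hΦlab : ∃ m₀, τl Φl = Sum.inr m₀ := by
    rcases hτΦ : τl Φl with j | m₀
    · exfalso
      refine hΦC ?_
      rw [hτ Φl, hτΦ, Sum.elim_inl, hCst]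
      exact Ideal.span_mono (Set.singleton_subset_iff.mpr ⟨j, rfl⟩)
    · exact ⟨m₀, rfl⟩
  obtain ⟨m₀, hm₀⟩ := hΦlab
  have hΦw : stalkIdeal Φ (π w') = Ideal.span {(W.presheaf.germ D.U (π w') D.hxU).hom (D.w m₀)} := by
    rw [show Φ = Φl.1 from rfl, hτ Φl, hm₀, Sum.elim_inr]
  refine ⟨d, v, lab (some (Sum.inl m₀)), lab none, hd, hv, hreg', (fun h => by cases hlab h), ?_, ?_, ?_, ?_⟩
  · rw [stalkIdeal_comap_eq_map_stalkMap, hΦw, Ideal.map_span, Set.image_singleton, hvl m₀, D.toStalk_eq,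
      D.algebraMap_reesChartBase]
  · rw [D.stalkIdeal_strictTransform_w hwC Φ m₀ hΦw, hvl m₀]
  · rw [D.stalkIdeal_exceptional hwC, hvn]
  · intro K hK hwK hne
    set Kl : {K // K ∈ L ∧ π w' ∈ K.support} := ⟨K, hK, hwK⟩ with hKl
    rcases hτK : τl Kl with j | m
    · have hKst : stalkIdeal K (π w') = Ideal.span {(W.presheaf.germ D.U (π w') D.hxU).hom (D.x j)} := by
        rw [show K = Kl.1 from rfl, hτ Kl, hτK, Sum.elim_inl]
      by_cases hj : j = D.i
      · left
        subst hj
        exact D.stalkIdeal_strictTransform_x_self hwC K hKst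
      · by_cases hQ : D.gen j ∈ D.Q
        · right
          refine ⟨lab (some (Sum.inr ⟨j, hj, hQ⟩)), (fun h => by cases hlab h), (fun h => by cases hlab h), ?_⟩
          rw [D.stalkIdeal_strictTransform_x hwC K hj hKst, hvr ⟨j, hj, hQ⟩]
        · left
          rw [D.stalkIdeal_strictTransform_x hwC K hj hKst]
          have hu : IsUnit (D.toStalk (D.gen j)) := by
            by_contra hu
            exact hQ ((D.chartGen_mem_Q_iff j).mpr ((IsLocalRing.mem_maximalIdeal _).mpr hu))
          exact Ideal.span_singleton_eq_top.mpr hu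
    · right
      have hmm : m ≠ m₀ := by
        intro hmm
        apply hne
        have : Kl = Φl := hτinj (by rw [hτK, hm₀, hmm])
        exact congrArg Subtype.val this
      have hKst : stalkIdeal K (π w') = Ideal.span {(W.presheaf.germ D.U (π w') D.hxU).hom (D.w m)} := by
        rw [show K = Kl.1 from rfl, hτ Kl, hτK, Sum.elim_inr]
      refine ⟨lab (some (Sum.inl m)), (fun h => hmm (by cases hlab h; rfl)), (fun h => by cases hlab h), ?_⟩
      rw [D.stalkIdeal_strictTransform_w hwC K m hKst, hvl m]

end Charts

section ChartsCor

variable {W W' : Scheme.{u}} [IsLocallyNoetherian W] [IsLocallyNoetherian W'] {π : W' ⟶ W} {C : W.IdealSheafData}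
  (hπ : IsBlowup π C) {L : List W.IdealSheafData} {Φ : W.IdealSheafData} (hΦ : Φ ∈ L) (w' : W')
  (hLC : π w' ∈ C.support → SNCWithAt L C (π w'))
  (hΦC : π w' ∈ C.support → π w' ∈ Φ.support → ¬ stalkIdeal Φ (π w') ≤ stalkIdeal C (π w'))

include hπ hΦ hLC hΦC in
/-- **A member transversal to the centre has strict transform = total transform, stalkwise**: `(St_π Φ)_{w'} = (Φ·𝒪_{W'})_{w'}`.
[cite: Kollar2007, Def. 3.25] [cite: GortzWedhorn2020, (13.19)] -/
theorem stalkIdeal_strictTransformIdeal_eq_comap_of_transversal :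
    stalkIdeal (strictTransformIdeal π C Φ) w' = stalkIdeal (Φ.comap π) w' := by
  by_cases hwC : π w' ∈ C.support
  · by_cases hwΦ : π w' ∈ Φ.support
    · obtain ⟨d, v, a₀, c₀, -, -, -, -, h1, h2, -, -⟩ :=
        exists_rsop_labels_over_centre hπ hΦ w' (hLC hwC) (hΦC hwC hwΦ) hwC hwΦ
      rw [h1, h2]
    · rw [stalkIdeal_strictTransformIdeal_eq_top_of_not_mem π C Φ hwΦ, stalkIdeal_eq_top_of_not_mem_support]
      rwa [Scheme.IdealSheafData.support_comap]
  · exact hπ.stalkIdeal_strictTransformIdeal_of_not_mem Φ hwC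

include hπ hΦ hLC hΦC in
/-- **Germs of strict transforms stay distinct from the germ of the transversal member**: if the germ of `K ∈ L` differs from the germ
of `Φ` at `π w'`, the same holds for `St_π K` and `Φ·𝒪_{W'}` at `w'`. [cite: Kollar2007, Def. 3.25] -/
theorem stalkIdeal_strictTransformIdeal_ne_comap {K : W.IdealSheafData} (hK : K ∈ L)
    (hne : π w' ∈ Φ.support → π w' ∈ K.support → stalkIdeal K (π w') ≠ stalkIdeal Φ (π w'))
    (hwΦ : w' ∈ (Φ.comap π).support) (hwK : w' ∈ (strictTransformIdeal π C K).support) :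
    stalkIdeal (strictTransformIdeal π C K) w' ≠ stalkIdeal (Φ.comap π) w' := by
  have hwΦ' : π w' ∈ Φ.support := by
    rw [Scheme.IdealSheafData.support_comap] at hwΦ; exact hwΦ
  have hwK' : π w' ∈ K.support := by
    by_contra h
    exact (mem_support_iff_stalkIdeal_ne_top _ _).mp hwK (stalkIdeal_strictTransformIdeal_eq_top_of_not_mem π C K h)
  have hKΦ : K ≠ Φ := fun h => hne hwΦ' hwK' (by rw [h])
  by_cases hwC : π w' ∈ C.support
  · obtain ⟨d, v, a₀, c₀, hd, hv, hreg, -, h1, -, -, hmem⟩ :=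
      exists_rsop_labels_over_centre hπ hΦ w' (hLC hwC) (hΦC hwC hwΦ') hwC hwΦ'
    haveI := hreg
    haveI := isDomain_of_isRegularLocalRing (W'.presheaf.stalk w')
    rcases hmem K hK hwK' hKΦ with htop | ⟨b, hb, -, hKb⟩
    · exact absurd htop ((mem_support_iff_stalkIdeal_ne_top _ _).mp hwK)
    · rw [hKb, h1, Ne, Ideal.span_singleton_eq_span_singleton]
      have hz : IsRsopPart v := by
        have := isRsopPart_comp_of_rsop hd v hv id Function.injective_id
        simpa using this
      exact hz.not_associated hb
  · haveI := hπ.isIso_stalkMap_of_not_mem_support hwC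
    rw [hπ.stalkIdeal_strictTransformIdeal_of_not_mem K hwC, Ne, stalkIdeal_comap_eq_iff_of_isIso_stalkMap]
    exact hne hwΦ' hwK'

include hπ hΦ hLC hΦC in
/-- The germ of the exceptional ideal differs from the germ of the transversal member's transform. [cite: Kollar2007, Def. 3.25] -/
theorem stalkIdeal_exceptional_ne_comap (hwΦ : w' ∈ (Φ.comap π).support) (hwC : w' ∈ (C.comap π).support) :
    stalkIdeal (C.comap π) w' ≠ stalkIdeal (Φ.comap π) w' := by
  rw [Scheme.IdealSheafData.support_comap] at hwΦ hwC
  obtain ⟨d, v, a₀, c₀, hd, hv, hreg, hac, h1, -, h3, -⟩ :=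
    exists_rsop_labels_over_centre hπ hΦ w' (hLC hwC) (hΦC hwC hwΦ) hwC hwΦ
  haveI := hreg
  haveI := isDomain_of_isRegularLocalRing (W'.presheaf.stalk w')
  rw [h1, h3, Ne, Ideal.span_singleton_eq_span_singleton]
  have hz : IsRsopPart v := by
    have := isRsopPart_comp_of_rsop hd v hv id Function.injective_id
    simpa using this
  exact hz.not_associated hac.symm

end ChartsCor

/-! ## Strict transforms commute with restriction to the models, stalkwise over the non-frame exceptional support -/

section StepStalks

variable {X X₂ F F₂ : Scheme.{u}} [IsLocallyNoetherian X] [IsLocallyNoetherian X₂] [IsLocallyNoetherian F₂]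
  {τX : X₂ ⟶ X} {C : X.IdealSheafData} (hτX : IsBlowup τX C) {jm : F ⟶ X} [IsClosedImmersion jm] {j' : F₂ ⟶ X₂} {υ : F₂ ⟶ F}
  (hpb : IsPullback j' υ τX jm) {L : List X.IdealSheafData} (hΦL : jm.ker ∈ L) {K : X.IdealSheafData} (hK : K ∈ L) (y : F₂)
  (hLC : τX (j' y) ∈ C.support → SNCWithAt L C (τX (j' y)))
  (hΦC : τX (j' y) ∈ C.support → τX (j' y) ∈ jm.ker.support → ¬ stalkIdeal jm.ker (τX (j' y)) ≤ stalkIdeal C (τX (j' y)))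
  (hne : τX (j' y) ∈ jm.ker.support → τX (j' y) ∈ K.support → stalkIdeal K (τX (j' y)) ≠ stalkIdeal jm.ker (τX (j' y)))

include hτX hpb hΦL hK hLC hΦC hne in
/-- **`((St_{τX} K)·𝒪_{F₂})_y = (St_υ (K·𝒪_F))_y`** at a point `y` of the new model whose image `τX (j' y)` carries snc data for
`jm.ker :: members` with the fibre transversal to the centre and to `K`: the free inclusion `≤` (`comap_strictTransformIdeal_le`), and `≥`
because `((St K)·𝒪_{F₂})_y` is saturated with respect to the exceptional ideal — over the centre the three germs «fibre, `St K`, exceptional»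
sit at distinct positions of a regular system of parameters of `𝒪_{X₂, j' y}` (`exists_rsop_labels_over_centre`), so the exceptional
parameter is a non-zero-divisor on `𝒪_{F₂,y}/(St K)_y = 𝒪_{X₂,j'y}/(fibre, St K)` (`colon_span_pow_le_of_isRsopPart`).
[cite: GortzWedhorn2020, (13.19)] [cite: Matsumura1987, Thm. 14.3] -/
theorem stalkIdeal_comap_strictTransformIdeal_eq_of_sncWithAt :
    stalkIdeal ((strictTransformIdeal τX C K).comap j') y = stalkIdeal (strictTransformIdeal υ (C.comap jm) (K.comap jm)) y := by
  have hcomm : j' ≫ τX = υ ≫ jm := hpb.w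
  haveI : IsClosedImmersion j' := isClosedImmersion_of_model_step hpb
  refine le_antisymm (stalkIdeal_mono (comap_strictTransformIdeal_le jm hcomm C K) y) ?_
  have hsurj : Function.Surjective (j'.stalkMap y).hom := j'.stalkMap_surjective y
  have hker : RingHom.ker (j'.stalkMap y).hom = stalkIdeal (jm.ker.comap τX) (j' y) := by
    rw [← ker_eq_comap_ker_of_model_step hpb, stalkIdeal_ker_eq_ker_stalkMap j' y]
  have hS : stalkIdeal ((strictTransformIdeal τX C K).comap j') y =
      (stalkIdeal (strictTransformIdeal τX C K) (j' y)).map (j'.stalkMap y).hom := stalkIdeal_comap_eq_map_stalkMap j' _ y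
  have hCc : (C.comap jm).comap υ = (C.comap τX).comap j' := by
    rw [← Scheme.IdealSheafData.comap_comp, ← Scheme.IdealSheafData.comap_comp, hcomm]
  have hKc : (K.comap jm).comap υ = (K.comap τX).comap j' := by
    rw [← Scheme.IdealSheafData.comap_comp, ← Scheme.IdealSheafData.comap_comp, hcomm]
  have hI : stalkIdeal ((C.comap jm).comap υ) y = (stalkIdeal (C.comap τX) (j' y)).map (j'.stalkMap y).hom := by
    rw [hCc]; exact stalkIdeal_comap_eq_map_stalkMap j' _ y
  have hK₂ : (stalkIdeal (K.comap jm) (υ y)).map (υ.stalkMap y).hom ≤ stalkIdeal ((strictTransformIdeal τX C K).comap j') y := by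
    rw [← stalkIdeal_comap_eq_map_stalkMap, hKc]
    exact stalkIdeal_mono (Scheme.IdealSheafData.comap_mono (f := j') (comap_le_strictTransformIdeal τX C K)) y
  rw [stalkIdeal_strictTransformIdeal υ (C.comap jm) (K.comap jm) y]
  refine iSup_le fun m => (Submodule.colon_mono hK₂ le_rfl).trans ?_
  rw [hI]
  -- the saturation of `S` by the exceptional ideal
  by_cases hxC : τX (j' y) ∈ C.support
  swap
  · rw [hτX.stalkIdeal_comap_centre_eq_top hxC, Ideal.map_top, Ideal.top_pow]
    intro s hs
    simpa using Submodule.mem_colon.mp hs 1 Submodule.mem_top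
  -- over the centre: `j' y` lies in the fibre
  have hxΦ : τX (j' y) ∈ jm.ker.support := by
    have h1 : j' y ∈ (jm.ker.comap τX).support := by
      rw [mem_support_iff_stalkIdeal_ne_top, ← hker]
      exact RingHom.ker_ne_top _
    rwa [Scheme.IdealSheafData.support_comap] at h1
  obtain ⟨d, v, a₀, c₀, hd, hv, hreg, hac, h1, -, h3, hmem⟩ :=
    exists_rsop_labels_over_centre hτX hΦL (j' y) (hLC hxC) (hΦC hxC hxΦ) hxC hxΦ
  haveI := hreg
  -- the trivial cases `St K = ⊤`
  have htriv : ∀ (T : Ideal (X₂.presheaf.stalk (j' y))), T = ⊤ →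
      Submodule.colon (T.map (j'.stalkMap y).hom)
        (((stalkIdeal (C.comap τX) (j' y)).map (j'.stalkMap y).hom ^ m : Ideal _) : Set _) ≤ T.map (j'.stalkMap y).hom := by
    intro T hT
    rw [hT, Ideal.map_top]
    exact fun _ _ => Submodule.mem_top
  by_cases hxK : τX (j' y) ∈ K.support
  swap
  · rw [hS]
    exact htriv _ (stalkIdeal_strictTransformIdeal_eq_top_of_not_mem τX C K hxK)
  have hKΦ : K ≠ jm.ker := fun h => hne hxΦ hxK (by rw [h])
  rcases hmem K hK hxK hKΦ with htop | ⟨b, hba, hbc, hKb⟩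
  · rw [hS]; exact htriv _ htop
  -- the regular triple `(v a₀, v b, v c₀)`
  have hz : IsRsopPart ![v a₀, v b, v c₀] := by
    have hinj : Function.Injective ![a₀, b, c₀] := by
      intro i j hij
      fin_cases i <;> fin_cases j <;> simp_all [hba.symm]
    have h := isRsopPart_comp_of_rsop hd v hv ![a₀, b, c₀] hinj
    convert h using 1
    ext i; fin_cases i <;> rfl
  have h0 : (j'.stalkMap y).hom (v a₀) = 0 := by
    rw [← RingHom.mem_ker, hker, h1]; exact Ideal.mem_span_singleton_self _
  have hkerle : RingHom.ker (j'.stalkMap y).hom ≤ Ideal.span {(![v a₀, v b, v c₀]) 0, (![v a₀, v b, v c₀]) 1} := by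
    rw [hker, h1]
    exact Ideal.span_mono (by simp)
  rw [hS, hKb, h3, Ideal.map_span, Set.image_singleton, Ideal.map_span, Set.image_singleton]
  exact colon_span_pow_le_of_isRsopPart _ hsurj hz h0 hkerle m

end StepStalks

end Summit.ResolutionOfSingularities.ResolutionOfSingularities.Cruxes.EquisingularLiftNat.Sections.ND

end
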